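import Mathlib.Analysis.Normed.Lp.lpSpace
import Mathlib.Analysis.Normed.Operator.Compact.Basic
import Mathlib.Analysis.Calculus.FDeriv.Basic
import Literature.Analysis.FunctionSpaces.SupNormFiniteNets
import HarnessLib

/-!
# Operators on closed subspaces of bounded functions with the sup norm

Analysis/FunctionSpaces support file (everything proved; no definitions, no named facts).
Function classes such as "continuous fields vanishing at infinity and weakly divergence free"
are conveniently realised as submodules `F` of Mathlib's `lp (fun _ : X => V) ⊤` (all bounded
functions `X → V`, sup norm `‖f‖ = sup ‖f x‖`); a closed such `F` is a Banach space with the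
instances inherited from `lp`.  This file provides the three generic tools by which operators
given **pointwise**, on functions, become operators on `F`:

* `exists_clm_of_pointwise` — a map `A` on functions which is additive and homogeneous on the
  class and maps it to itself with a sup bound `‖A g‖ ≤ Λ sup ‖g‖` is a continuous linear
  operator `F →L[ℝ] F` of norm `≤ Λ` (Mathlib's `LinearMap.mkContinuous`);
* `isCompactOperator_of_tails_of_equicontinuous` — on a proper space `X` with values in a proper
  `V`, a continuous linear `K : F →L[ℝ] F` whose image of the unit ball is uniformly small at
  infinity and uniformly equicontinuous is a **compact operator** (Arzelà–Ascoli modulo tails: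
  the tree's finite sup-norm nets `exists_finite_sup_net` make the image totally bounded;
  Rudin, *Functional Analysis*, Thm. A5 / *Principles* Thm. 7.25);
* `hasStrictFDerivAt_zero_of_pointwise` — a self-map `P` of `F` with the pointwise estimate
  `‖(P g₁ − P g₂ − L(g₁ − g₂))(x)‖ ≤ ε ‖g₁ − g₂‖` for `‖g₁‖, ‖g₂‖ < δ(ε)` is strictly
  differentiable at `0` with derivative `L`.

## Mathlib search

`lp`, `memℓp_infty`, `lp.norm_apply_le_norm`, `lp.norm_le_of_forall_le`,
`LinearMap.mkContinuous(_norm_le)`, `isCompactOperator_iff_isCompact_closure_image_closedBall`,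
`Metric.totallyBounded_iff`, `isCompact_iff_totallyBounded_isComplete`,
`hasStrictFDerivAt_iff_isLittleO`, `Asymptotics.isLittleO_iff`.

## References

* W. Rudin, *Principles of Mathematical Analysis*, 3rd ed., Thm. 7.25; *Functional Analysis*,
  2nd ed., Appendix A5 (Arzelà–Ascoli) and Def. 4.16 (compact operators). [folklore]
-/

noncomputable section

open Set Metric Function Filter
open _root_.Topology

namespace Literature.Analysis.FunctionSpaces

section Lift

variable {X : Type*} {V : Type*} [NormedAddCommGroup V] [NormedSpace ℝ V]

/-- Elements of a submodule of `ℓ^∞(X; V)` are bounded pointwise by their norm. [folklore] -/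
theorem norm_apply_le_norm_submodule (F : Submodule ℝ (lp (fun _ : X => V) ⊤)) (f : F) (x : X) :
    ‖f.1 x‖ ≤ ‖f‖ := by
  have h := lp.norm_apply_le_norm ENNReal.top_ne_zero f.1 x
  simpa using h

/-- The norm of an element of a submodule of `ℓ^∞(X; V)` is at most any uniform bound. [folklore] -/
theorem norm_le_of_forall_le_submodule (F : Submodule ℝ (lp (fun _ : X => V) ⊤)) (f : F) {C : ℝ}
    (hC : 0 ≤ C) (h : ∀ x, ‖f.1 x‖ ≤ C) : ‖f‖ ≤ C := by
  have h' := lp.norm_le_of_forall_le hC h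
  simpa using h'

/-- **Pointwise operators lift to bounded operators.** Let `F` be a submodule of `ℓ^∞(X; V)`
whose membership is a property `P` of the underlying function, and let `A` act on functions,
additively and homogeneously on the class `P`, mapping bounded members of `P` to members of `P`
with the sup bound `‖A g (x)‖ ≤ Λ B` whenever `‖g‖ ≤ B`.  Then there is `L : F →L[ℝ] F` with
`(L f)(x) = A f (x)` and `‖L‖ ≤ Λ`. [folklore] -/
theorem exists_clm_of_pointwise (F : Submodule ℝ (lp (fun _ : X => V) ⊤)) {P : (X → V) → Prop}
    (hP : ∀ f : lp (fun _ : X => V) ⊤, f ∈ F ↔ P ⇑f) (A : (X → V) → (X → V)) {Λ : ℝ} (hΛ : 0 ≤ Λ)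
    (hadd : ∀ g h : X → V, P g → P h → A (g + h) = A g + A h)
    (hsmul : ∀ (r : ℝ) (g : X → V), P g → A (r • g) = r • A g)
    (hmap : ∀ g : X → V, P g → ∀ B : ℝ, (∀ x, ‖g x‖ ≤ B) → P (A g) ∧ ∀ x, ‖A g x‖ ≤ Λ * B) :
    ∃ L : F →L[ℝ] F, (∀ (f : F) (x : X), (L f).1 x = A (⇑f.1) x) ∧ ‖L‖ ≤ Λ := by
  have hPf : ∀ f : F, P ⇑f.1 := fun f => (hP f.1).1 f.2
  have hbd : ∀ f : F, ∀ x, ‖A (⇑f.1) x‖ ≤ Λ * ‖f‖ := fun f =>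
    (hmap _ (hPf f) ‖f‖ (norm_apply_le_norm_submodule F f)).2
  have hmem : ∀ f : F, Memℓp (A ⇑f.1) ⊤ := fun f =>
    memℓp_infty ⟨Λ * ‖f‖, by rintro _ ⟨x, rfl⟩; exact hbd f x⟩
  have hF : ∀ f : F, (⟨A ⇑f.1, hmem f⟩ : lp (fun _ : X => V) ⊤) ∈ F := fun f =>
    (hP _).2 (hmap _ (hPf f) ‖f‖ (norm_apply_le_norm_submodule F f)).1
  set T : F → F := fun f => ⟨⟨A ⇑f.1, hmem f⟩, hF f⟩ with hT
  have hTapp : ∀ (f : F) (x : X), (T f).1 x = A (⇑f.1) x := fun f x => rfl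
  have hTadd : ∀ f g : F, T (f + g) = T f + T g := by
    intro f g
    refine Subtype.ext (lp.ext (funext fun x => ?_))
    simp only [Submodule.coe_add, lp.coeFn_add, Pi.add_apply, hTapp]
    rw [hadd _ _ (hPf f) (hPf g), Pi.add_apply]
  have hTsmul : ∀ (r : ℝ) (f : F), T (r • f) = r • T f := by
    intro r f
    refine Subtype.ext (lp.ext (funext fun x => ?_))
    simp only [Submodule.coe_smul, lp.coeFn_smul, Pi.smul_apply, hTapp]
    rw [hsmul r _ (hPf f), Pi.smul_apply]
  set Tl : F →ₗ[ℝ] F := { toFun := T, map_add' := hTadd, map_smul' := hTsmul } with hTl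
  have hTl_bd : ∀ f : F, ‖Tl f‖ ≤ Λ * ‖f‖ := fun f =>
    norm_le_of_forall_le_submodule F (T f) (mul_nonneg hΛ (norm_nonneg _)) (hbd f)
  refine ⟨Tl.mkContinuous Λ hTl_bd, fun f x => rfl, Tl.mkContinuous_norm_le hΛ hTl_bd⟩

end Lift

section Compact

variable {X : Type*} [PseudoMetricSpace X] [ProperSpace X]
variable {V : Type*} [NormedAddCommGroup V] [NormedSpace ℝ V] [ProperSpace V]

/-- **Compactness from uniform tails and equicontinuity** (Arzelà–Ascoli modulo tails). Let `F`
be a closed submodule of `ℓ^∞(X; V)`, `X` a proper space, `V` a proper normed space, and let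
`K : F →L[ℝ] F` map the unit ball to a family of functions which is uniformly small outside
large balls around `x₀` and uniformly equicontinuous.  Then `K` is a compact operator: by the
finite sup-norm nets of `exists_finite_sup_net` the image of the unit ball is totally bounded,
hence relatively compact in the complete space `F` (Rudin, *Functional Analysis*, A5). [folklore] -/
theorem isCompactOperator_of_tails_of_equicontinuous (F : Submodule ℝ (lp (fun _ : X => V) ⊤))
    (hF : IsClosed (F : Set (lp (fun _ : X => V) ⊤))) (K : F →L[ℝ] F) (x₀ : X)
    (htail : ∀ ε : ℝ, 0 < ε → ∃ A : ℝ, ∀ f : F, ‖f‖ ≤ 1 → ∀ x, A ≤ dist x x₀ → ‖(K f).1 x‖ ≤ ε)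
    (hequi : ∀ ε : ℝ, 0 < ε → ∃ δ : ℝ, 0 < δ ∧ ∀ f : F, ‖f‖ ≤ 1 →
      ∀ x y, dist x y < δ → ‖(K f).1 x - (K f).1 y‖ ≤ ε) :
    IsCompactOperator K := by
  haveI : CompleteSpace F := hF.completeSpace_coe
  -- the image of the closed unit ball is totally bounded
  have htb : TotallyBounded ((K : F → F) '' closedBall (0 : F) 1) := by
    refine Metric.totallyBounded_iff.2 fun ε hε => ?_
    set S : Set (X → V) := {g | ∃ f : F, ‖f‖ ≤ 1 ∧ g = ⇑(K f).1} with hS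
    have hbdS : ∀ g ∈ S, ∀ x, ‖g x‖ ≤ ‖K‖ := by
      rintro g ⟨f, hf, rfl⟩ x
      refine (norm_apply_le_norm_submodule F (K f) x).trans ?_
      calc ‖K f‖ ≤ ‖K‖ * ‖f‖ := K.le_opNorm f
        _ ≤ ‖K‖ * 1 := by gcongr
        _ = ‖K‖ := mul_one _
    have htailS : ∀ ε : ℝ, 0 < ε → ∃ A : ℝ, ∀ g ∈ S, ∀ x, A ≤ dist x x₀ → ‖g x‖ ≤ ε := by
      intro ε hε
      obtain ⟨A, hA⟩ := htail ε hε
      refine ⟨A, ?_⟩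
      rintro g ⟨f, hf, rfl⟩ x hx
      exact hA f hf x hx
    have hequiS : ∀ ε : ℝ, 0 < ε → ∃ δ : ℝ, 0 < δ ∧ ∀ g ∈ S, ∀ x y, dist x y < δ →
        ‖g x - g y‖ ≤ ε := by
      intro ε hε
      obtain ⟨δ, hδ, hδf⟩ := hequi ε hε
      refine ⟨δ, hδ, ?_⟩
      rintro g ⟨f, hf, rfl⟩ x y hxy
      exact hδf f hf x y hxy
    obtain ⟨t, htS, htfin, hnet⟩ :=
      exists_finite_sup_net x₀ S hbdS htailS hequiS (half_pos hε)
    -- pull the finite net back to `F`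
    set ev : F → (X → V) := fun e => ⇑e.1 with hev
    have hinj : Injective ev := fun e e' h => Subtype.ext (lp.ext h)
    set T : Set F := ev ⁻¹' t with hT
    have hTfin : T.Finite := htfin.preimage hinj.injOn
    refine ⟨T, hTfin, ?_⟩
    rintro _ ⟨f, hf, rfl⟩
    rw [mem_closedBall, dist_zero_right] at hf
    obtain ⟨g', hg't, hg'⟩ := hnet _ ⟨f, hf, rfl⟩
    obtain ⟨f', hf', hgf'⟩ := htS hg't
    have hmemT : K f' ∈ T := by
      show ev (K f') ∈ t
      rw [hev]
      simpa only [← hgf'] using hg't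
    refine mem_iUnion₂.2 ⟨K f', hmemT, ?_⟩
    rw [mem_ball, dist_eq_norm]
    refine lt_of_le_of_lt (norm_le_of_forall_le_submodule F _ (half_pos hε).le fun x => ?_)
      (half_lt_self hε)
    have h1 := hg' x
    rw [hgf'] at h1
    simpa using h1
  have hcpt : IsCompact (closure ((K : F → F) '' closedBall (0 : F) 1)) :=
    isCompact_iff_totallyBounded_isComplete.2 ⟨htb.closure, isClosed_closure.isComplete⟩
  have h := (isCompactOperator_iff_isCompact_closure_image_closedBall (K : F →ₗ[ℝ] F) one_pos).2
    (by simpa using hcpt)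
  simpa using h

end Compact

section StrictDeriv

variable {X : Type*} {V : Type*} [NormedAddCommGroup V] [NormedSpace ℝ V]

/-- **Strict differentiability at `0` from a pointwise remainder estimate.** If for every
`ε > 0` there is `δ > 0` such that `‖(P g₁ − P g₂ − L(g₁ − g₂))(x)‖ ≤ ε ‖g₁ − g₂‖` for all
`x` whenever `‖g₁‖, ‖g₂‖ < δ`, then `P` has the strict Fréchet derivative `L` at `0` (the sup
of the pointwise bounds is the norm in `ℓ^∞`). [folklore] -/
theorem hasStrictFDerivAt_zero_of_pointwise (F : Submodule ℝ (lp (fun _ : X => V) ⊤))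
    {P : F → F} {L : F →L[ℝ] F}
    (h : ∀ ε : ℝ, 0 < ε → ∃ δ : ℝ, 0 < δ ∧ ∀ g₁ g₂ : F, ‖g₁‖ < δ → ‖g₂‖ < δ →
      ∀ x, ‖((P g₁).1 x - (P g₂).1 x) - (L (g₁ - g₂)).1 x‖ ≤ ε * ‖g₁ - g₂‖) :
    HasStrictFDerivAt P L 0 := by
  rw [hasStrictFDerivAt_iff_isLittleO, Asymptotics.isLittleO_iff]
  intro c hc
  obtain ⟨δ, hδ, hδP⟩ := h c hc
  have hball : ball (0 : F × F) δ ∈ 𝓝 (0 : F × F) := ball_mem_nhds _ hδ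
  filter_upwards [hball] with p hp
  rw [mem_ball_zero_iff] at hp
  have hp1 : ‖p.1‖ < δ := lt_of_le_of_lt (norm_fst_le p) hp
  have hp2 : ‖p.2‖ < δ := lt_of_le_of_lt (norm_snd_le p) hp
  refine norm_le_of_forall_le_submodule F _ (mul_nonneg hc.le (norm_nonneg _)) fun x => ?_
  have h1 := hδP p.1 p.2 hp1 hp2 x
  simpa using h1

end StrictDeriv

end Literature.Analysis.FunctionSpaces

end
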